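import Summits.AtomisticToContinuum.BoseEinsteinCondensation.Theses.BECConjugateDomination
import Literature.MathematicalPhysics.QuantumManyBody.PeriodicBoseGasJastrow
import HarnessLib

/-!
# The lattice cosine: level shells trapped between spheres around `Lℤ³`
(negative-side toolkit for crux `PuffFloor`, stmt-AtomisticToContinuum-11785; cycle 3, Targets)

Cycle-3 file of the refuter's negative-side chain for crux `PuffFloor` of route
`BECConjugateDomination` (cdisprove seat gen 3, 2026-08-16). A device for SMOOTH PERIODIC two-body
states localised in a spherical shell around coincidence (used by `CorePairDominationKinetic.lean`
to show that the kinetic term of stub S1 `stub_corePairDomination` of line `coupling-slope-pocket` is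
load-bearing):

* `latticeCos` — `c(y) = ∑ₐ cos(2π yₐ/L)`: smooth (`contDiff_latticeCos`), even, `Lℤ³`-periodic;
* `three_sub_latticeCos_le`, `le_three_sub_latticeCos` — `8 d(y)²/L² ≤ 3 − c(y) ≤ 2π² d(y)²/L²`,
  `d(y) = ‖reduce L y‖` the distance to the NEAREST lattice point `L·nearestLat` of
  `PeriodicBoseGasJastrow` (Kober `cos t ≤ 1 − 2t²/π²` on
  `[−π, π]`, and `1 − t²/2 ≤ cos t`); `half_le_norm_sub_latticeVec` — every other lattice point is
  `≥ L/2` away (contrapositive of `nearestLat_eq_of_norm_lt`);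
* `periodizedPotential_core_eq_zero` — where `c(y) < 3 − 2π²r₀²/L²` (and `2r₀ ≤ L`) the periodised
  core indicator `(c·1_{[0,r₀)})^per` vanishes; `one_le_periodizedPotential_count` — where
  `3 − 8R²/L² < c(y)` the periodised counting indicator `(1_{[0,R]})^per` is `≥ 1`.

No Theses statement is asserted positively. All `[folklore]`.
-/

noncomputable section

namespace Summit.AtomisticToContinuum.BoseEinsteinCondensation.Theorems.PuffFloor.Negative

open Literature.MathematicalPhysics.QuantumManyBody.BoseGas MeasureTheory
open scoped ENNReal NNReal BigOperators

variable {L : ℝ}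

/-! ### The lattice cosine `c(y) = ∑ₐ cos(2π yₐ / L)` -/

/-- The lattice cosine `c(y) = ∑ₐ cos(2π yₐ/L)`: smooth, `Lℤ³`-periodic, even, `≤ 3` with equality
exactly on `Lℤ³`. [folklore] -/
def latticeCos (L : ℝ) (y : Space) : ℝ := ∑ a : Fin 3, Real.cos (2 * Real.pi * y a / L)

/-- `c` is smooth. [folklore] -/
theorem contDiff_latticeCos (L : ℝ) {n : ℕ∞} : ContDiff ℝ n (latticeCos L) := by
  unfold latticeCos
  refine ContDiff.sum fun a _ => Real.contDiff_cos.comp ?_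
  exact ((contDiff_const.mul (contDiff_piLp_apply (p := 2) (i := a))).div_const L)

/-- `c` is even. [folklore] -/
theorem latticeCos_neg (L : ℝ) (y : Space) : latticeCos L (-y) = latticeCos L y := by
  unfold latticeCos
  refine Finset.sum_congr rfl fun a _ => ?_
  rw [PiLp.neg_apply, mul_neg, neg_div, Real.cos_neg]

/-- `c` is `Lℤ³`-periodic (generator form). [folklore] -/
theorem latticeCos_add_single (hL : L ≠ 0) (y : Space) (k : Fin 3) :
    latticeCos L (y + EuclideanSpace.single k L) = latticeCos L y := by
  unfold latticeCos
  refine Finset.sum_congr rfl fun a _ => ?_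
  rw [PiLp.add_apply, PiLp.single_apply]
  split_ifs with h
  · have : 2 * Real.pi * (y a + L) / L = 2 * Real.pi * y a / L + (1 : ℤ) * (2 * Real.pi) := by
      push_cast; field_simp
    rw [this, Real.cos_add_int_mul_two_pi]
  · rw [add_zero]

/-- Periodicity, subtractive form. [folklore] -/
theorem latticeCos_sub_single (hL : L ≠ 0) (y : Space) (k : Fin 3) :
    latticeCos L (y - EuclideanSpace.single k L) = latticeCos L y := by
  conv_rhs => rw [← sub_add_cancel y (EuclideanSpace.single k L)]
  rw [latticeCos_add_single hL]

/-! ### Distance to the nearest lattice point (`nearestLat`, `reduce` of `PeriodicBoseGasJastrow`) -/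

/-- Each cosine only sees the offset from the nearest lattice point. [folklore] -/
theorem cos_coord_eq_cos_offset (hL : L ≠ 0) (y : Space) (a : Fin 3) :
    Real.cos (2 * Real.pi * y a / L) = Real.cos (2 * Real.pi * reduce L y a / L) := by
  rw [reduce_apply]
  have : 2 * Real.pi * y a / L =
      2 * Real.pi * (y a - L * (round (y a / L) : ℝ)) / L + (round (y a / L) : ℤ) * (2 * Real.pi) := by
    field_simp
    ring
  rw [this, Real.cos_add_int_mul_two_pi]

/-- `3 − c(y) = ∑ₐ (1 − cos(2π dₐ/L))` with `d` the offset from the nearest lattice point. [folklore] -/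
theorem three_sub_latticeCos_eq (hL : L ≠ 0) (y : Space) :
    3 - latticeCos L y = ∑ a : Fin 3, (1 - Real.cos (2 * Real.pi * reduce L y a / L)) := by
  unfold latticeCos
  rw [Finset.sum_sub_distrib, Finset.sum_const, Finset.card_univ, Fintype.card_fin]
  simp only [nsmul_eq_mul, Nat.cast_ofNat, mul_one]
  congr 1
  exact Finset.sum_congr rfl fun a _ => cos_coord_eq_cos_offset hL y a

/-- **Upper trapping**: `3 − c(y) ≤ (2π²/L²) · d(y)²`. [folklore] -/
theorem three_sub_latticeCos_le (hL : L ≠ 0) (y : Space) :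
    3 - latticeCos L y ≤ 2 * Real.pi ^ 2 / L ^ 2 * ‖reduce L y‖ ^ 2 := by
  rw [three_sub_latticeCos_eq hL, EuclideanSpace.real_norm_sq_eq, Finset.mul_sum]
  refine Finset.sum_le_sum fun a _ => ?_
  have h := Real.one_sub_sq_div_two_le_cos (x := 2 * Real.pi * reduce L y a / L)
  have : (2 * Real.pi * reduce L y a / L) ^ 2 / 2 = 2 * Real.pi ^ 2 / L ^ 2 * reduce L y a ^ 2 := by
    ring
  linarith

/-- **Lower trapping** (Kober): `(8/L²) · d(y)² ≤ 3 − c(y)`. [folklore] -/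
theorem le_three_sub_latticeCos (hL : 0 < L) (y : Space) :
    8 / L ^ 2 * ‖reduce L y‖ ^ 2 ≤ 3 - latticeCos L y := by
  rw [three_sub_latticeCos_eq hL.ne' y, EuclideanSpace.real_norm_sq_eq, Finset.mul_sum]
  refine Finset.sum_le_sum fun a _ => ?_
  set d : ℝ := reduce L y a with hd
  have hda : |d| ≤ L / 2 := abs_reduce_apply_le hL y a
  have habs : |2 * Real.pi * d / L| ≤ Real.pi := by
    rw [abs_div, abs_of_pos hL, abs_mul, abs_of_pos (by positivity : (0 : ℝ) < 2 * Real.pi),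
      div_le_iff₀ hL]
    nlinarith [Real.pi_pos]
  have h := Real.cos_le_one_sub_mul_cos_sq habs
  have hπ : Real.pi ≠ 0 := Real.pi_ne_zero
  have : 2 / Real.pi ^ 2 * (2 * Real.pi * d / L) ^ 2 = 8 / L ^ 2 * d ^ 2 := by
    field_simp
    ring
  linarith

/-- **Other lattice points are far**: for `q ≠ nearestLat L y`, `‖y − Lq‖ ≥ L/2` (contrapositive
of `nearestLat_eq_of_norm_lt`). [folklore] -/
theorem half_le_norm_sub_latticeVec (hL : 0 < L) (y : Space) {q : Fin 3 → ℤ}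
    (hq : q ≠ nearestLat L y) : L / 2 ≤ ‖y - latticeVec L q‖ := by
  by_contra h
  exact hq (nearestLat_eq_of_norm_lt hL (not_le.1 h)).symm

/-! ### Consequences of the trapping for the two indicator potentials -/

/-- **Inside the shell there is no core energy.** If `c(y) < 3 − 2π²r₀²/L²` and `2r₀ ≤ L`, every
lattice image of `y` is at distance `≥ r₀`: the periodised core potential vanishes at `y`. [folklore] -/
theorem periodizedPotential_core_eq_zero (hL : 0 < L) {r₀ : ℝ} (hr₀L : 2 * r₀ ≤ L) (c : ℝ≥0∞)
    {y : Space} (hy : latticeCos L y < 3 - 2 * Real.pi ^ 2 * r₀ ^ 2 / L ^ 2) :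
    periodizedPotential (Set.indicator (Set.Iio r₀) (fun _ : ℝ => c)) L y = 0 := by
  unfold periodizedPotential
  refine ENNReal.tsum_eq_zero.2 fun q => ?_
  refine Set.indicator_of_notMem ?_ _
  simp only [Set.mem_Iio, not_lt]
  by_cases hq : q = nearestLat L y
  · subst hq
    change r₀ ≤ ‖reduce L y‖
    have h1 := three_sub_latticeCos_le hL.ne' y
    have h2 : 2 * Real.pi ^ 2 * r₀ ^ 2 / L ^ 2 < 2 * Real.pi ^ 2 / L ^ 2 * ‖reduce L y‖ ^ 2 := by
      linarith
    rw [div_mul_eq_mul_div, div_lt_div_iff_of_pos_right (by positivity)] at h2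
    have h3 : r₀ ^ 2 < ‖reduce L y‖ ^ 2 := by
      nlinarith [Real.pi_pos, sq_nonneg Real.pi]
    by_cases hr : r₀ ≤ 0
    · exact hr.trans (norm_nonneg _)
    · exact (abs_lt_of_sq_lt_sq' h3 (norm_nonneg _)).2.le
  · have := half_le_norm_sub_latticeVec hL y hq
    linarith

/-- **Inside the shell the pair is counted.** If `3 − 8R²/L² < c(y)` (`0 ≤ R`), the nearest image is
within `R`: the periodised counting indicator is `≥ 1` at `y`. [folklore] -/
theorem one_le_periodizedPotential_count (hL : 0 < L) {R : ℝ} (hR : 0 ≤ R) {y : Space}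
    (hy : 3 - 8 * R ^ 2 / L ^ 2 < latticeCos L y) :
    1 ≤ periodizedPotential (Set.indicator (Set.Iic R) (fun _ : ℝ => (1 : ℝ≥0∞))) L y := by
  unfold periodizedPotential
  refine le_trans (le_of_eq ?_)
    (ENNReal.le_tsum (f := fun q : Fin 3 → ℤ =>
      Set.indicator (Set.Iic R) (fun _ : ℝ => (1 : ℝ≥0∞)) ‖y - latticeVec L q‖) (nearestLat L y))
  symm
  refine Set.indicator_of_mem ?_ _
  simp only [Set.mem_Iic]
  change ‖reduce L y‖ ≤ R
  have h1 := le_three_sub_latticeCos hL y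
  have h2 : 8 / L ^ 2 * ‖reduce L y‖ ^ 2 < 8 * R ^ 2 / L ^ 2 := by linarith
  rw [div_mul_eq_mul_div, div_lt_div_iff_of_pos_right (by positivity)] at h2
  have h3 : ‖reduce L y‖ ^ 2 < R ^ 2 := by nlinarith
  exact (abs_lt_of_sq_lt_sq' h3 hR).2.le

end Summit.AtomisticToContinuum.BoseEinsteinCondensation.Theorems.PuffFloor.Negative

end
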